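import Literature.Geometry.Riemannian.CyclicCoverProper
import Literature.Geometry.MetricGeometry.Submetry
import HarnessLib

/-!
# The infinite cyclic cover as a proper metric space with isometric deck action, and the
isometry `M̂/ℤ ≅ M` (Huang–Huang–Wang–Zhu 2026, §4: "`M̂ᵢ/Hᵢ = Mᵢ`")

H. Huang, X.-T. Huang, J. Wang, X. Zhu, arXiv:2605.24380 (2026), §4, p. 13, work with the
Riemannian covers `M̂ᵢ` of closed manifolds `Mᵢ` with free abelian deck group `Hᵢ`
("`Hᵢ = (Γᵢ/[Γᵢ,Γᵢ])/Tᵢ` is a finitely generated free Abelian group with `rank(Hᵢ) = b`, and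
`M̂ᵢ/Hᵢ = Mᵢ`"), as *pointed proper metric spaces with closed groups of isometries*, the objects of
pointed equivariant Gromov–Hausdorff convergence (§2.1, p. 6, Thm 2.1; diagram (4.1):
`(M̂ᵢ, p̂ᵢ, Hᵢ) → (ℝˢ × Ŷ, (0ˢ, ŷ_∞), H)` over `(Mᵢ, pᵢ) → (X, p_∞)`), and use tacitly that the
covering projection is a submetry inducing an isometry of the orbit space `M̂ᵢ/Hᵢ` onto `Mᵢ`.

For the `b = 1` case of their Main Theorem 1 (the named fact
`Literature.Geometry.Riemannian.huangHuangWangZhu2026_fibresOverCircle_four`) the cover is the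
tree's infinite cyclic cover `X̂ = CircleMaps.CyclicCover f` of a Riemannian manifold `(X, g)` along
`f : C(X, 𝕊¹)`, with lifted metric `ĝ = proj^* g` (`CyclicCoverMetric.lean`), Riemannian distance
`d̂` (`CyclicCoverDistance.lean`: `proj` is distance non-increasing, `inf_k d̂(x̂, k +ᵥ p̂) =
d(proj x̂, proj p̂)`), and compact `d̂`-balls when `X` is compact (`CyclicCoverProper.lean`). This
file packages these in Mathlib's metric-space vocabulary — the vocabulary of the tree's
Gromov–Hausdorff files `Literature/Geometry/MetricGeometry/{Submetry, GromovHausdorffApprox,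
PointedGromovHausdorff, EquivariantGHLimit}.lean` — so that `(X̂, p̂, ℤ)` is literally such an object:

§1. For any Riemannian `g` on a connected Hausdorff manifold `M`: the metric space structure
`g.metricSpace hg` of the Riemannian distance (`dist x y = d_g(x, y)`, Mathlib's
`EMetricSpace.ofRiemannianMetric` made real-valued by the finiteness of `d_g` on connected
manifolds; its topology is the manifold topology, `rfl`), `1`-Lipschitz maps from norm
non-increasing differentials, and **Hopf–Rinow in the form "complete ⇒ proper"**
(`properSpace_of_isGeodesicallyComplete`, from the tree's `isCompact_setOf_edist_le`,
O'Neill 1983, Ch. 5, Thm. 21).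

§2. For the connected cyclic cover `X̂` of `(X, g)`: the metric space `cyclicCoverMetricSpace f g hg`
of `d̂`; the deck group acts by isometries (`IsIsometricVAdd ℤ X̂`, hence Mathlib's
`IsIsometricSMul (Multiplicative ℤ) X̂`); `X̂` is a proper metric space when `X` is complete, in
particular when `X` is compact (`properSpace_cyclicCover`); `proj` is `1`-Lipschitz; the `ℤ`-orbits
are the fibres of `proj` and are closed; `infDist x̂ (ℤ +ᵥ p̂) = dist (proj x̂) (proj p̂)`, attained
when `X` is compact; every orbit is `diam X`-dense (cocompactness); **`proj` is a submetry**
(`isSubmetry_cyclicCover_proj`); and **the orbit space `X̂/ℤ` with its orbit metric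
(`instPseudoMetricSpaceOrbitRelQuotient`) is isometric to `X`** (`cyclicCoverOrbitIsometryEquiv`:
"`M̂ᵢ/Hᵢ = Mᵢ`" as metric spaces).

Everything is a definition with body or a proved theorem; no named facts.

## References

* H. Huang, X.-T. Huang, J. Wang, X. Zhu, *Fibrations, the first Betti number, and almost
  nonnegative Ricci curvature*, arXiv:2605.24380 (2026), §2.1 (p. 6), Thm 2.1, §4 (p. 13,
  "`M̂ᵢ/Hᵢ = Mᵢ`", diagram (4.1)). [HuangHuangWangZhu2026]
* B. O'Neill, *Semi-Riemannian Geometry* (1983), Ch. 5, Def. 15, Prop. 18 (the Riemannian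
  distance is a metric inducing the topology), Thm. 21 (Hopf–Rinow), Ch. 7, pp. 191–192
  (Riemannian coverings). [ONeill1983]
* K. Fukaya, T. Yamaguchi, *The fundamental groups of almost nonnegatively curved manifolds*,
  Ann. of Math. 136 (1992) 253–333, §3 (equivariant pointed Hausdorff convergence of
  `(M̃, Γ)`).
-/

noncomputable section

open Bundle Set Filter Function Metric
open scoped Manifold ContDiff Topology ENNReal NNReal

namespace Literature.Geometry.Riemannian

open Literature.Geometry.Lorentzian Literature.Geometry.Lorentzian.PseudoRiemannianMetric
  Literature.Geometry.Manifold Literature.Geometry.MetricGeometry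
  Literature.Topology.FourManifolds.CircleMaps Literature.Topology.FourManifolds.CircleMaps.CyclicCover

/-! ### §1. The metric space of a Riemannian metric on a connected manifold -/

section General

variable {E : Type*} [NormedAddCommGroup E] [NormedSpace ℝ E] [FiniteDimensional ℝ E]
  {H : Type*} [TopologicalSpace H] {I : ModelWithCorners ℝ E H}
  {M : Type*} [TopologicalSpace M] [ChartedSpace H M] [IsManifold I ∞ M]
  {n : ℕ∞ω} {g : PseudoRiemannianMetric I n E (TangentSpace I : M → Type _)}

variable (g) in
/-- **The metric space of a Riemannian manifold** (O'Neill 1983, Ch. 5, Prop. 18: on a connected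
Riemannian manifold the Riemannian distance `d` is a metric and its topology is the manifold
topology): the `MetricSpace` structure on `M` with `dist x y = d_g(x, y)` (the real value of the
tree's `g.edist hg`, finite on connected manifolds, `edist_ne_top`), built from Mathlib's
`PseudoEMetricSpace.ofRiemannianMetric` so that its topology is *definitionally* the given one. A
`def`, not an instance: activate it with `letI := g.metricSpace hg`.
[cite: ONeill1983, Ch. 5, Prop. 18 (pp. 135–136)] -/
@[reducible] def _root_.Literature.Geometry.Lorentzian.PseudoRiemannianMetric.metricSpace
    [PreconnectedSpace M] [T2Space M] (hg : g.IsRiemannian) : MetricSpace M :=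
  haveI : LocallyCompactSpace M := Manifold.locallyCompact_of_finiteDimensional I
  letI := g.riemannianBundle hg
  haveI := g.isContinuousRiemannianBundle hg
  letI : PseudoEMetricSpace M := .ofRiemannianMetric I M
  letI : PseudoMetricSpace M :=
    PseudoEMetricSpace.toPseudoMetricSpace fun x y ↦ PseudoRiemannianMetric.edist_ne_top hg x y
  MetricSpace.ofT0PseudoMetricSpace M

variable [PreconnectedSpace M] [T2Space M] (hg : g.IsRiemannian)

/-- The topology of `g.metricSpace hg` is the manifold topology (by construction, `rfl`).
[cite: ONeill1983, Ch. 5, Prop. 18] -/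
theorem _root_.Literature.Geometry.Lorentzian.PseudoRiemannianMetric.metricSpace_topology_eq :
    (g.metricSpace hg).toPseudoMetricSpace.toUniformSpace.toTopologicalSpace = ‹TopologicalSpace M› :=
  rfl

/-- Under `g.metricSpace hg`, `edist x y = d_g(x, y)`. [cite: ONeill1983, Ch. 5, Def. 15] -/
theorem _root_.Literature.Geometry.Lorentzian.PseudoRiemannianMetric.metricSpace_edist (x y : M) :
    letI := g.metricSpace hg
    edist x y = g.edist hg x y := by
  letI := g.metricSpace hg
  rw [edist_dist]
  show ENNReal.ofReal (g.edist hg x y).toReal = _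
  exact ENNReal.ofReal_toReal (PseudoRiemannianMetric.edist_ne_top hg x y)

/-- Under `g.metricSpace hg`, `dist x y = d_g(x, y)` as a real number.
[cite: ONeill1983, Ch. 5, Def. 15] -/
theorem _root_.Literature.Geometry.Lorentzian.PseudoRiemannianMetric.metricSpace_dist (x y : M) :
    letI := g.metricSpace hg
    dist x y = (g.edist hg x y).toReal :=
  rfl

/-- Closed balls of `g.metricSpace hg` are the sublevel sets `{y | d_g(x, y) ≤ r}` of the tree's
distance (`r ≥ 0`). [cite: ONeill1983, Ch. 5, Def. 15] -/
theorem _root_.Literature.Geometry.Lorentzian.PseudoRiemannianMetric.metricSpace_closedBall_eq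
    (x : M) (r : ℝ≥0) :
    letI := g.metricSpace hg
    closedBall x r = {y | g.edist hg x y ≤ r} := by
  letI := g.metricSpace hg
  ext y
  rw [mem_closedBall, dist_comm, mem_setOf_eq, metricSpace_dist,
    ← ENNReal.toReal_le_toReal (PseudoRiemannianMetric.edist_ne_top hg x y) ENNReal.coe_ne_top,
    ENNReal.coe_toReal]

/-- Open balls of `g.metricSpace hg` are the sets `{y | d_g(x, y) < r}`.
[cite: ONeill1983, Ch. 5, Def. 15] -/
theorem _root_.Literature.Geometry.Lorentzian.PseudoRiemannianMetric.metricSpace_ball_eq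
    (x : M) (r : ℝ) :
    letI := g.metricSpace hg
    ball x r = {y | g.edist hg x y < ENNReal.ofReal r} := by
  letI := g.metricSpace hg
  ext y
  rw [mem_ball, dist_comm, mem_setOf_eq, metricSpace_dist]
  rcases le_or_gt r 0 with hr | hr
  · simp only [ENNReal.ofReal_of_nonpos hr, ENNReal.not_lt_zero, iff_false, not_lt]
    exact hr.trans ENNReal.toReal_nonneg
  · exact (ENNReal.lt_ofReal_iff_toReal_lt (PseudoRiemannianMetric.edist_ne_top hg x y)).symm

/-- **Heine–Borel ⇒ proper**: if the closed `d_g`-balls `{y | d_g(x, y) ≤ r}` are compact, the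
metric space `g.metricSpace hg` is proper. [cite: ONeill1983, Ch. 5, Thm. 21] -/
theorem _root_.Literature.Geometry.Lorentzian.PseudoRiemannianMetric.properSpace_of_isCompact_setOf_edist_le
    (h : ∀ (x : M) (r : ℝ≥0), IsCompact {y | g.edist hg x y ≤ r}) :
    letI := g.metricSpace hg
    ProperSpace M := by
  letI := g.metricSpace hg
  refine ⟨fun x r ↦ ?_⟩
  rcases le_or_gt 0 r with hr | hr
  · lift r to ℝ≥0 using hr
    rw [metricSpace_closedBall_eq hg x r]
    exact h x r
  · rw [closedBall_eq_empty.2 hr]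
    exact isCompact_empty

/-- A `C¹` map between connected Riemannian manifolds whose differential does not increase norms
is `1`-Lipschitz for the Riemannian distances (`riemannianEDist_comp_le`).
[cite: ONeill1983, Ch. 3, pp. 90–91] -/
theorem lipschitzWith_one_of_norm_mfderiv_le
    {E' : Type*} [NormedAddCommGroup E'] [NormedSpace ℝ E'] [FiniteDimensional ℝ E']
    {H' : Type*} [TopologicalSpace H'] {I' : ModelWithCorners ℝ E' H'}
    {M' : Type*} [TopologicalSpace M'] [ChartedSpace H' M'] [IsManifold I' ∞ M']
    [PreconnectedSpace M'] [T2Space M'] {n' : ℕ∞ω}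
    {g' : PseudoRiemannianMetric I' n' E' (TangentSpace I' : M' → Type _)} (hg' : g'.IsRiemannian)
    {Ψ : M → M'} (hΨ : ContMDiff I I' 1 Ψ)
    (hle : letI := g.riemannianBundle hg; letI := g'.riemannianBundle hg'
      ∀ (x : M) (v : TangentSpace I x), ‖mfderiv I I' Ψ x v‖ ≤ ‖v‖) :
    letI := g.metricSpace hg
    letI := g'.metricSpace hg'
    LipschitzWith 1 Ψ := by
  letI := g.metricSpace hg
  letI := g'.metricSpace hg'
  refine LipschitzWith.of_edist_le fun x y ↦ ?_
  rw [metricSpace_edist hg, metricSpace_edist hg']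
  letI := g.riemannianBundle hg
  letI := g'.riemannianBundle hg'
  exact riemannianEDist_comp_le hΨ hle x y

end General

/-! ### §1'. Hopf–Rinow: complete connected Riemannian manifolds are proper metric spaces -/

section Complete

variable {E : Type*} [NormedAddCommGroup E] [NormedSpace ℝ E] {H : Type*} [TopologicalSpace H]
  {I : ModelWithCorners ℝ E H} {M : Type*} [TopologicalSpace M] [ChartedSpace H M]
  [IsManifold I ∞ M] {n : ℕ∞ω} [FiniteDimensional ℝ E] [CompleteSpace E] [T2Space M]
  [ConnectedSpace M] [BoundarylessManifold I M]
  (g : PseudoRiemannianMetric I n E (TangentSpace I : M → Type _)) [g.HasLeviCivita]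
  [CovariantDerivative.ContMDiffCovariantDerivative g.leviCivita 1]

/-- **Hopf–Rinow, (C) ⇒ proper** (O'Neill 1983, Ch. 5, Thm. 21; Lee 2018, Thm. 6.19): a connected
geodesically complete Riemannian manifold, with the metric space structure of its Riemannian
distance, is a proper metric space — closed balls are compact (the tree's
`isCompact_setOf_edist_le`). [cite: ONeill1983, Ch. 5, Thm. 21 (p. 138)] -/
theorem _root_.Literature.Geometry.Lorentzian.PseudoRiemannianMetric.properSpace_of_isGeodesicallyComplete
    (hn : (∞ : ℕ∞ω) ≤ n) (hg : g.IsRiemannian) (hc : IsGeodesicallyComplete g.leviCivita) :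
    letI := g.metricSpace hg
    ProperSpace M :=
  properSpace_of_isCompact_setOf_edist_le hg (isCompact_setOf_edist_le g hn hg hc)

end Complete

/-! ### §2₀. The orbits of the deck group are the fibres (topology only) -/

section CoverTopology

variable {X : Type*} [TopologicalSpace X] (f : C(X, Circle))

/-- **The `ℤ`-orbits are the fibres of the covering projection**:
`ℤ +ᵥ p̂ = proj⁻¹(proj p̂)`. [folklore] -/
theorem cyclicCover_orbit_eq_preimage_proj (p : CyclicCover f) :
    AddAction.orbit ℤ p = (proj : CyclicCover f → X) ⁻¹' {proj p} := by
  ext x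
  simp only [AddAction.mem_orbit_iff, mem_preimage, mem_singleton_iff]
  constructor
  · rintro ⟨k, rfl⟩
    exact proj_vadd k p
  · intro h
    exact exists_vadd_eq_of_proj_eq h

/-- The `ℤ`-orbits of the cyclic cover of a `T₁` space are closed. [folklore] -/
theorem isClosed_cyclicCover_orbit [T1Space X] (p : CyclicCover f) :
    IsClosed (AddAction.orbit ℤ p : Set (CyclicCover f)) := by
  rw [cyclicCover_orbit_eq_preimage_proj]
  exact (isClosed_singleton).preimage continuous_proj

/-- The base of a connected cover is preconnected. [folklore] -/
theorem preconnectedSpace_of_connectedSpace_cyclicCover [ConnectedSpace (CyclicCover f)] : PreconnectedSpace X :=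
  ⟨by
    have h := (isPreconnected_univ (α := CyclicCover f)).image (proj : CyclicCover f → X)
      (continuous_proj (f := f)).continuousOn
    rwa [image_univ_of_surjective (proj_surjective (f := f))] at h⟩

end CoverTopology

/-! ### §2. The cyclic cover: proper metric space, isometric deck action, `X̂/ℤ ≅ X` -/

section Cover

variable {E : Type*} [NormedAddCommGroup E] [NormedSpace ℝ E] [FiniteDimensional ℝ E]
  {H : Type*} [TopologicalSpace H] {I : ModelWithCorners ℝ E H}
  {X : Type*} [TopologicalSpace X] [ChartedSpace H X] [IsManifold I ∞ X] [T2Space X]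
  (f : C(X, Circle)) (g : PseudoRiemannianMetric I ∞ E (TangentSpace I : X → Type _))

/-- **The metric space `(X̂, d̂)`**: the connected infinite cyclic cover with the Riemannian distance
of the lifted metric `proj^* g` (the pointed proper metric spaces `(M̂ᵢ, d̂ᵢ)` of
Huang–Huang–Wang–Zhu 2026, §4, for `b = 1`). A `def`; activate with
`letI := cyclicCoverMetricSpace f g hg`. [cite: HuangHuangWangZhu2026, §4 p. 13] -/
@[reducible] def cyclicCoverMetricSpace [ConnectedSpace (CyclicCover f)] (hg : g.IsRiemannian) :
    MetricSpace (CyclicCover f) :=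
  (liftMetric f g).metricSpace (isRiemannian_liftMetric f g hg)

variable {g} [ConnectedSpace (CyclicCover f)] (hg : g.IsRiemannian)

/-- `dist x̂ ŷ = d̂(x̂, ŷ)`, the Riemannian distance of the lifted metric.
[cite: HuangHuangWangZhu2026, §4 p. 13] -/
theorem cyclicCover_dist_eq (x y : CyclicCover f) :
    letI := cyclicCoverMetricSpace f g hg
    dist x y = ((liftMetric f g).edist (isRiemannian_liftMetric f g hg) x y).toReal :=
  rfl

/-- `edist x̂ ŷ = d̂(x̂, ŷ)`. [cite: HuangHuangWangZhu2026, §4 p. 13] -/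
theorem cyclicCover_edist_eq (x y : CyclicCover f) :
    letI := cyclicCoverMetricSpace f g hg
    edist x y = (liftMetric f g).edist (isRiemannian_liftMetric f g hg) x y :=
  metricSpace_edist _ x y

/-- **The deck group acts on `(X̂, d̂)` by isometries** (`Hᵢ < Isom(M̂ᵢ)`; the deck translations
are isometries of `proj^* g`, `edist_liftMetric_vadd`). Consequently Mathlib provides
`IsIsometricSMul (Multiplicative ℤ) X̂`, the isometries `IsometryEquiv.constVAdd k`, `dist_vadd`, ….
[cite: HuangHuangWangZhu2026, §4 p. 13] -/
theorem isIsometricVAdd_cyclicCover :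
    letI := cyclicCoverMetricSpace f g hg
    IsIsometricVAdd ℤ (CyclicCover f) := by
  letI := cyclicCoverMetricSpace f g hg
  exact ⟨fun k x y ↦ by
    rw [cyclicCover_edist_eq, cyclicCover_edist_eq]
    exact edist_liftMetric_vadd f g hg k x y⟩

/-- **The covering projection is `1`-Lipschitz**, `d(proj x̂, proj ŷ) ≤ d̂(x̂, ŷ)`
(`edist_proj_le`). [cite: ONeill1983, Ch. 7, pp. 191–192] -/
theorem lipschitzWith_one_cyclicCover_proj [PreconnectedSpace X] :
    letI := cyclicCoverMetricSpace f g hg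
    letI := g.metricSpace hg
    LipschitzWith 1 (proj : CyclicCover f → X) := by
  letI := cyclicCoverMetricSpace f g hg
  letI := g.metricSpace hg
  refine LipschitzWith.of_edist_le fun x y ↦ ?_
  rw [cyclicCover_edist_eq, metricSpace_edist hg]
  exact edist_proj_le f hg x y

/-- `dist (proj x̂) (proj ŷ) ≤ dist x̂ ŷ`. [cite: ONeill1983, Ch. 7, pp. 191–192] -/
theorem dist_cyclicCover_proj_le [PreconnectedSpace X] (x y : CyclicCover f) :
    letI := cyclicCoverMetricSpace f g hg
    letI := g.metricSpace hg
    dist (proj x) (proj y) ≤ dist x y := by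
  letI := cyclicCoverMetricSpace f g hg
  letI := g.metricSpace hg
  simpa using (lipschitzWith_one_cyclicCover_proj f hg).dist_le_mul x y

/-- **Lifting at distance `< r`**: if `d(proj x̂, proj p̂) < r` then `d̂(x̂, k +ᵥ p̂) < r` for some
deck translation `k` (`exists_edist_vadd_lt`). [cite: ONeill1983, Ch. 7, pp. 191–192] -/
theorem exists_dist_vadd_lt [PreconnectedSpace X] {x p : CyclicCover f} {r : ℝ}
    (h : letI := g.metricSpace hg; dist (proj x) (proj p) < r) :
    letI := cyclicCoverMetricSpace f g hg
    ∃ k : ℤ, dist x (k +ᵥ p) < r := by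
  letI := cyclicCoverMetricSpace f g hg
  letI := g.metricSpace hg
  have hr : 0 < r := dist_nonneg.trans_lt h
  have h' : g.edist hg (proj x) (proj p) < ENNReal.ofReal r := by
    rw [← metricSpace_edist hg, edist_dist]
    exact (ENNReal.ofReal_lt_ofReal_iff hr).2 h
  obtain ⟨k, hk⟩ := exists_edist_vadd_lt f hg h'
  refine ⟨k, ?_⟩
  rw [cyclicCover_dist_eq]
  exact (ENNReal.lt_ofReal_iff_toReal_lt (PseudoRiemannianMetric.edist_ne_top _ _ _)).1 hk

/-- **The distance to an orbit is the distance in the base**: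
`infDist x̂ (ℤ +ᵥ p̂) = d(proj x̂, proj p̂)` (`iInf_edist_vadd_eq`).
[cite: ONeill1983, Ch. 7, pp. 191–192] -/
theorem infDist_cyclicCover_orbit_eq [PreconnectedSpace X] (x p : CyclicCover f) :
    letI := cyclicCoverMetricSpace f g hg
    letI := g.metricSpace hg
    infDist x (AddAction.orbit ℤ p : Set (CyclicCover f)) = dist (proj x) (proj p) := by
  letI := cyclicCoverMetricSpace f g hg
  letI := g.metricSpace hg
  have hne : (AddAction.orbit ℤ p : Set (CyclicCover f)).Nonempty := ⟨p, AddAction.mem_orbit_self p⟩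
  rw [infDist, infEDist, metricSpace_dist hg]
  congr 1
  rw [← iInf_edist_vadd_eq f hg x p]
  apply le_antisymm
  · refine le_iInf fun k ↦ ?_
    refine (iInf₂_le (k +ᵥ p) (AddAction.mem_orbit p k)).trans_eq ?_
    exact cyclicCover_edist_eq f hg x (k +ᵥ p)
  · refine le_iInf₂ fun y hy ↦ ?_
    obtain ⟨k, rfl⟩ := AddAction.mem_orbit_iff.1 hy
    exact (iInf_le _ k).trans_eq (cyclicCover_edist_eq f hg x (k +ᵥ p)).symm

/-- **The orbit distance**: `⨅ k, d̂(x̂, k +ᵥ p̂) = d(proj x̂, proj p̂)` in real numbers.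
[cite: ONeill1983, Ch. 7, pp. 191–192] -/
theorem iInf_dist_vadd_eq [PreconnectedSpace X] (x p : CyclicCover f) :
    letI := cyclicCoverMetricSpace f g hg
    letI := g.metricSpace hg
    ⨅ k : ℤ, dist x (k +ᵥ p) = dist (proj x) (proj p) := by
  letI := cyclicCoverMetricSpace f g hg
  letI := g.metricSpace hg
  rw [← infDist_cyclicCover_orbit_eq f hg x p, infDist_eq_iInf]
  haveI : Nonempty (AddAction.orbit ℤ p) := ⟨⟨p, AddAction.mem_orbit_self p⟩⟩
  apply le_antisymm
  · refine le_ciInf fun y ↦ ?_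
    obtain ⟨k, hk⟩ := AddAction.mem_orbit_iff.1 y.2
    refine (ciInf_le ⟨0, forall_mem_range.2 fun _ ↦ dist_nonneg⟩ k).trans_eq ?_
    rw [hk]
  · refine le_ciInf fun k ↦ ?_
    exact ciInf_le ⟨0, forall_mem_range.2 fun _ ↦ dist_nonneg⟩
      (⟨k +ᵥ p, AddAction.mem_orbit p k⟩ : AddAction.orbit ℤ p)

/-- **The covering projection `(X̂, d̂) → (X, d)` is a submetry**: `proj (B_r(x̂)) = B_r(proj x̂)`
for every `r > 0` (Huang–Huang–Wang–Zhu 2026 use the submetry `M̂ᵢ → Mᵢ = M̂ᵢ/Hᵢ` throughout §4).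
[cite: HuangHuangWangZhu2026, §4 p. 13] -/
theorem isSubmetry_cyclicCover_proj [PreconnectedSpace X] :
    letI := cyclicCoverMetricSpace f g hg
    letI := g.metricSpace hg
    IsSubmetry (proj : CyclicCover f → X) := by
  letI := cyclicCoverMetricSpace f g hg
  letI := g.metricSpace hg
  haveI := isIsometricVAdd_cyclicCover f hg
  intro p r _
  apply Subset.antisymm
  · rintro _ ⟨x, hx, rfl⟩
    exact mem_ball.2 ((dist_cyclicCover_proj_le f hg x p).trans_lt (mem_ball.1 hx))
  · intro y hy
    obtain ⟨q, hq⟩ := proj_surjective (f := f) y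
    subst hq
    obtain ⟨k, hk⟩ := exists_dist_vadd_lt f hg (x := q) (p := p) (mem_ball.1 hy)
    refine ⟨(-k) +ᵥ q, mem_ball.2 ?_, proj_vadd (-k) q⟩
    calc dist ((-k) +ᵥ q) p = dist (k +ᵥ ((-k) +ᵥ q)) (k +ᵥ p) := (dist_vadd k _ _).symm
      _ = dist q (k +ᵥ p) := by rw [vadd_vadd, add_neg_cancel, zero_vadd]
      _ < r := hk

/-- **The distance on the orbit space `X̂/ℤ` is the distance in the base**: for the orbit metric of
the isometric action of (`Multiplicative`) `ℤ` (`instPseudoMetricSpaceOrbitRelQuotient`: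
`dist ⟦x̂⟧ ⟦ŷ⟧ = ⨅ k, d̂(x̂, k • ŷ)`), `dist ⟦x̂⟧ ⟦ŷ⟧ = d(proj x̂, proj ŷ)`.
[cite: HuangHuangWangZhu2026, §4 p. 13] -/
theorem dist_orbitMk_cyclicCover_eq [PreconnectedSpace X] (x y : CyclicCover f) :
    letI := cyclicCoverMetricSpace f g hg
    letI := g.metricSpace hg
    haveI := isIsometricVAdd_cyclicCover f hg
    dist (⟦x⟧ : MulAction.orbitRel.Quotient (Multiplicative ℤ) (CyclicCover f)) ⟦y⟧ =
      dist (proj x) (proj y) := by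
  letI := cyclicCoverMetricSpace f g hg
  letI := g.metricSpace hg
  haveI := isIsometricVAdd_cyclicCover f hg
  rw [dist_mk_mk, ← iInf_dist_vadd_eq f hg x y]
  exact (Multiplicative.toAdd (α := ℤ)).iInf_comp (g := fun k : ℤ ↦ dist x (k +ᵥ y))

/-- **`M̂/H = M` as metric spaces** (Huang–Huang–Wang–Zhu 2026, §4, p. 13: "`M̂ᵢ/Hᵢ = Mᵢ`"): the
orbit space of the deck action on the connected cyclic cover, with its orbit metric, is isometric to
the base with its Riemannian distance, via the map induced by `proj` (well defined and injective
because the orbits are the fibres of `proj`, surjective because `proj` is, isometric by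
`dist_orbitMk_cyclicCover_eq`). [cite: HuangHuangWangZhu2026, §4 p. 13] -/
def cyclicCoverOrbitIsometryEquiv [PreconnectedSpace X] :
    letI := cyclicCoverMetricSpace f g hg
    letI := g.metricSpace hg
    haveI := isIsometricVAdd_cyclicCover f hg
    MulAction.orbitRel.Quotient (Multiplicative ℤ) (CyclicCover f) ≃ᵢ X :=
  letI := cyclicCoverMetricSpace f g hg
  letI := g.metricSpace hg
  haveI := isIsometricVAdd_cyclicCover f hg
  { toFun := Quotient.lift (s := MulAction.orbitRel (Multiplicative ℤ) (CyclicCover f))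
      (proj : CyclicCover f → X) fun a b hab ↦ by
        obtain ⟨k, rfl⟩ := MulAction.orbitRel_apply.1 hab
        exact proj_vadd (Multiplicative.toAdd k) b
    invFun := fun x ↦ ⟦base f x⟧
    left_inv := fun q ↦ Quotient.inductionOn q fun x ↦ by
      obtain ⟨k, hk⟩ := exists_vadd_eq_of_proj_eq (proj_base (f := f) (proj x))
      exact Quotient.sound (MulAction.orbitRel_apply.2 ⟨Multiplicative.ofAdd k, hk⟩)
    right_inv := fun x ↦ proj_base (f := f) x
    isometry_toFun := Isometry.of_dist_eq fun q q' ↦ Quotient.inductionOn₂ q q' fun x y ↦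
      (dist_orbitMk_cyclicCover_eq f hg x y).symm }

/-- The isometry `X̂/ℤ ≃ᵢ X` sends the orbit of `x̂` to `proj x̂`. [cite: HuangHuangWangZhu2026, §4 p. 13] -/
@[simp] theorem cyclicCoverOrbitIsometryEquiv_mk [PreconnectedSpace X] (x : CyclicCover f) :
    letI := cyclicCoverMetricSpace f g hg
    letI := g.metricSpace hg
    haveI := isIsometricVAdd_cyclicCover f hg
    cyclicCoverOrbitIsometryEquiv f hg ⟦x⟧ = proj x :=
  rfl

/-- The isometry `X̂/ℤ ≃ᵢ X` composed with the orbit map is `proj`. [cite: HuangHuangWangZhu2026, §4 p. 13] -/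
theorem cyclicCoverOrbitIsometryEquiv_comp_mk [PreconnectedSpace X] :
    letI := cyclicCoverMetricSpace f g hg
    letI := g.metricSpace hg
    haveI := isIsometricVAdd_cyclicCover f hg
    (cyclicCoverOrbitIsometryEquiv f hg : _ → X) ∘
        (fun x ↦ (⟦x⟧ : MulAction.orbitRel.Quotient (Multiplicative ℤ) (CyclicCover f))) = proj :=
  rfl

end Cover

/-! ### §2'. Properness and cocompactness for complete (in particular compact) bases -/

section CoverProper

variable {E : Type*} [NormedAddCommGroup E] [NormedSpace ℝ E]
  {H : Type*} [TopologicalSpace H] {I : ModelWithCorners ℝ E H}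
  {X : Type*} [TopologicalSpace X] [ChartedSpace H X] [IsManifold I ∞ X]
  [FiniteDimensional ℝ E] [CompleteSpace E] [T2Space X] [I.Boundaryless]
  (f : C(X, Circle)) {g : PseudoRiemannianMetric I ∞ E (TangentSpace I : X → Type _)}
  [g.HasLeviCivita] [(liftMetric f g).HasLeviCivita] [ConnectedSpace (CyclicCover f)]
  (hg : g.IsRiemannian)

/-- **The cyclic cover of a complete manifold is a proper metric space**: closed `d̂`-balls are
compact (`isCompact_setOf_edist_liftMetric_le`: the cover is complete, O'Neill 1983, Ch. 7,
Cor. 29, and Hopf–Rinow). [cite: ONeill1983, Ch. 5, Thm. 21 and Ch. 7, Cor. 29] -/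
theorem properSpace_cyclicCover_of_isGeodesicallyComplete
    (hc : IsGeodesicallyComplete g.leviCivita) :
    letI := cyclicCoverMetricSpace f g hg
    ProperSpace (CyclicCover f) :=
  properSpace_of_isCompact_setOf_edist_le _ (isCompact_setOf_edist_liftMetric_le f g hg hc)

/-- **The cyclic cover of a compact manifold is a proper metric space** — the `M̂ᵢ` of
Huang–Huang–Wang–Zhu 2026, §4, are pointed *proper* metric spaces, as pointed Gromov–Hausdorff
convergence requires (§2.1, p. 6). [cite: HuangHuangWangZhu2026, §2.1 p. 6 and §4 p. 13] -/
theorem properSpace_cyclicCover [CompactSpace X] :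
    letI := cyclicCoverMetricSpace f g hg
    ProperSpace (CyclicCover f) :=
  properSpace_of_isCompact_setOf_edist_le _
    (isCompact_setOf_edist_liftMetric_le_of_compactSpace f g hg)

omit [CompleteSpace E] [I.Boundaryless] [g.HasLeviCivita] [(liftMetric f g).HasLeviCivita] in
/-- **Dense orbits / cocompactness in metric terms**: over a compact base every point of the cover
is within `diam X` of every orbit: `∃ k, dist x̂ (k +ᵥ p̂) ≤ diam X` — indeed the infimum
`d(proj x̂, proj p̂) ≤ diam X` of the distances to the closed orbit is attained in the proper space
`X̂`. (Huang–Huang–Wang–Zhu 2026, §4: `diam(Mᵢ) ≤ 1`, so the `Hᵢ`-orbits are `1`-dense.)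
[cite: HuangHuangWangZhu2026, §4 p. 13] -/
theorem exists_dist_vadd_eq_dist_proj [CompactSpace X] [PreconnectedSpace X]
    (hP : letI := cyclicCoverMetricSpace f g hg; ProperSpace (CyclicCover f))
    (x p : CyclicCover f) :
    letI := cyclicCoverMetricSpace f g hg
    letI := g.metricSpace hg
    ∃ k : ℤ, dist x (k +ᵥ p) = dist (proj x) (proj p) := by
  letI := cyclicCoverMetricSpace f g hg
  letI := g.metricSpace hg
  haveI := hP
  obtain ⟨y, hy, hxy⟩ := (isClosed_cyclicCover_orbit f p).exists_infDist_eq_dist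
    ⟨p, AddAction.mem_orbit_self p⟩ x
  obtain ⟨k, rfl⟩ := AddAction.mem_orbit_iff.1 hy
  exact ⟨k, by rw [← hxy, infDist_cyclicCover_orbit_eq f hg x p]⟩

omit [CompleteSpace E] [I.Boundaryless] [g.HasLeviCivita] [(liftMetric f g).HasLeviCivita] in
/-- **Cocompactness**: over a compact base, for every `p̂` and `x̂` some deck translate `k +ᵥ x̂`
lies in the closed ball `closedBall p̂ (diam X)` — a compact set when `X̂` is proper.
[cite: HuangHuangWangZhu2026, §4 p. 13] -/
theorem exists_vadd_mem_closedBall_diam [CompactSpace X] [PreconnectedSpace X]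
    (hP : letI := cyclicCoverMetricSpace f g hg; ProperSpace (CyclicCover f))
    (p x : CyclicCover f) :
    letI := cyclicCoverMetricSpace f g hg
    letI := g.metricSpace hg
    ∃ k : ℤ, k +ᵥ x ∈ closedBall p (diam (univ : Set X)) := by
  letI := cyclicCoverMetricSpace f g hg
  letI := g.metricSpace hg
  haveI := isIsometricVAdd_cyclicCover f hg
  obtain ⟨k, hk⟩ := exists_dist_vadd_eq_dist_proj f hg hP x p
  refine ⟨-k, mem_closedBall.2 ?_⟩
  calc dist ((-k) +ᵥ x) p = dist (k +ᵥ ((-k) +ᵥ x)) (k +ᵥ p) := (dist_vadd k _ _).symm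
    _ = dist x (k +ᵥ p) := by rw [vadd_vadd, add_neg_cancel, zero_vadd]
    _ = dist (proj x) (proj p) := hk
    _ ≤ diam (univ : Set X) := dist_le_diam_of_mem isCompact_univ.isBounded (mem_univ _) (mem_univ _)

end CoverProper

end Literature.Geometry.Riemannian
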